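import Summits.HodgeConjecture.HodgeConjecture.Theorems.Ring2WeilCoverageCMFieldCarrierGalois
import Mathlib.NumberTheory.Cyclotomic.Basic
import Mathlib.RingTheory.Polynomial.Cyclotomic.Roots
import HarnessLib

/-!
# Ring 2 — Weil-type family-coverage census, CM-field rows (X-O): the census carriers `S² + 5S + 5`, `S² + 6S + 1`,
# `S² + 8S + 4` ARE the cyclotomic fields `ℚ(ζ₅)`, `ℚ(ζ₈)`, `ℚ(ζ₁₂)` — `IsCyclotomicExtension {n} ℚ E` in the kernel

HONEST FRAMING: research route conditional on HC_CM; not a corollary; Q11.4-sentence-2 already refuted in dim ≥ 3.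

Cell `pub-hodge-ring2`, seat `ring2-b03` (gen 56), census `WEIL-FAMILY-COVERAGE.md` «## b03» b03.5: the row KEY `K` of the census
schema is a FIELD, while the kernel tables (parts I–W) and the member theorems (parts X-J – X-N) live on Deligne's CARRIERS
`E = cmField R = ℚ[T]/(R(T²))`. For the three census rows whose key is a cyclotomic field this file proves the identification
in the kernel: an explicit primitive `n`-th root of unity `ζ ∈ E`, written as a polynomial in `η` and checked against
`η⁴ + pη² + q = 0` by `linear_combination`, generates `E` over `ℚ`, so `IsCyclotomicExtension {n} ℚ E` (Mathlib):

| carrier `R` | `(p,q)` | `ζ` | check | `η` from roots of unity |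
|---|---|---|---|---|
| `S² + 5S + 5` | `(5,5)` | `ζ₅ = (η − η² − 3)/2` | `Φ₅(ζ) = ζ⁴ + ζ³ + ζ² + ζ + 1 = 0` | `η = ζ − ζ⁴ = ζ₅ − ζ₅⁻¹` |
| `S² + 6S + 1` | `(6,1)` | `ζ₈ = (η³ − η² + 7η − 3)/4` | `Φ₈(ζ) = ζ⁴ + 1 = 0` | `η = ζ + ζ² + ζ³ = i(1 + √2)` |
| `S² + 8S + 4` | `(8,4)` | `ζ₁₂ = i·ω`, `i = −(η³ + 6η)/4`, `ω = (η³ + 10η − 4)/8` | `Φ₄(i) = 0`, `Φ₃(ω) = 0`, `ord(iω) = 12` | `η = 1 + i + 2ω = i(1 + √3)` |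

* §1 `ℚ(ζ₅)`: `zeta5_isPrimitiveRoot`, **`zeta5_isCyclotomicExtension`**.
* §2 `ℚ(ζ₈)`: `zeta8_isPrimitiveRoot`, **`zeta8_isCyclotomicExtension`**.
* §3 `ℚ(ζ₁₂)`: `zeta12_isPrimitiveRoot_four`, `zeta12_isPrimitiveRoot_three`, `zeta12_isPrimitiveRoot`,
  **`zeta12_isCyclotomicExtension`**.
* §4 `ℚ(√-(2+√2))` (`S² + 4S + 2`, the cyclic CM subfield of `ℚ(ζ₁₆)`): `sqrtNegTwoPlusSqrtTwo_exists_ringHom_of_isPrimitiveRoot`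
  (`η ↦ ζ₁₆ − ζ₁₆⁻¹` into any field with a primitive 16th root of unity, e.g. `CyclotomicField 16 ℚ`; `ζ⁸ = −1`).

THEOREMS ONLY: no `def`, no named fact, no `sorry`; `HC_CM` does not occur; nothing about the Hodge conjecture is asserted
(pure field theory of the census carriers; with parts X-L – X-N the b03.5 labels `ℚ(ζ₅)` (C₄), `ℚ(ζ₈)`, `ℚ(ζ₁₂)` (V₄) are
kernel facts about the carriers).

## References
* [Deligne1982HodgeCycles] P. Deligne (notes by J. S. Milne), LNM 900 (1982), §4 (the presentation `E = ℚ(η)`, `η̄ = −η`).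
* [Washington1997] L. C. Washington, *Introduction to Cyclotomic Fields*, 2nd ed., GTM 83 (1997), Ch. 2 (`ℚ(ζ_n)`,
  `[ℚ(ζ_n):ℚ] = φ(n)`, the subfields `ℚ(ζ₈) = ℚ(i,√2)`, `ℚ(ζ₁₂) = ℚ(i,√3)`).
-/

noncomputable section

set_option linter.dupNamespace false

namespace Summit.HodgeConjecture.HodgeConjecture.Ring2.WeilCoverageCM

open Polynomial NumberField
open Literature.AlgebraicGeometry.Deligne1982

/-- `E = ℚ(η)` generates: if `η ∈ adjoin ℚ S` then `adjoin ℚ S` is everything. [folklore] -/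
theorem mem_adjoin_of_cmRoot_mem (R : Polynomial ℤ) [Fact (Irreducible (cmPolyQ R))] {S : Set (cmField R)}
    (h : cmRoot R ∈ Algebra.adjoin ℚ S) (x : cmField R) : x ∈ Algebra.adjoin ℚ S := by
  have htop : Algebra.adjoin ℚ ({cmRoot R} : Set (cmField R)) = ⊤ := AdjoinRoot.adjoinRoot_eq_top
  have hle : Algebra.adjoin ℚ ({cmRoot R} : Set (cmField R)) ≤ Algebra.adjoin ℚ S :=
    Algebra.adjoin_le (Set.singleton_subset_iff.2 h)
  rw [htop] at hle
  exact hle Algebra.mem_top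

/-! ## §1 `S² + 5S + 5`: `E = ℚ(ζ₅)` -/

section Zeta5

variable {R : Polynomial ℤ} (hR : R = X ^ 2 + C 5 * X + C 5)
include hR

/-- **`ζ₅ = (η − η² − 3)/2` is a primitive 5th root of unity in `E = ℚ[T]/(T⁴ + 5T² + 5)`** (`Φ₅(ζ) = 0`; `η = ζ₅ − ζ₅⁻¹`,
`η² = ζ₅² + ζ₅⁻² − 2 = −(5+√5)/2`). [cite: Washington1997, Ch. 2] -/
theorem zeta5_isPrimitiveRoot [Fact (Irreducible (cmPolyQ R))] :
    IsPrimitiveRoot ((cmRoot R - cmRoot R ^ 2 - 3) / 2 : cmField R) 5 := by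
  have ht := cmRoot_quartic R hR
  push_cast at ht
  haveI : Fact (Nat.Prime 5) := ⟨Nat.prime_five⟩
  refine Polynomial.isRoot_cyclotomic_iff.1 ?_
  rw [Polynomial.cyclotomic_prime, Polynomial.IsRoot.def]
  simp only [Finset.sum_range_succ, Finset.sum_range_zero, eval_add, eval_pow, eval_X, eval_one, zero_add, pow_zero]
  linear_combination
    (cmRoot R ^ 4 / 16 - cmRoot R ^ 3 / 4 + 11 / 16 * cmRoot R ^ 2 - 7 / 8 * cmRoot R + 11 / 16) * ht

/-- **`E = ℚ[T]/(T⁴ + 5T² + 5)` is the 5th cyclotomic field: `IsCyclotomicExtension {5} ℚ E`** (`ζ₅ ∈ E` primitive and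
`η = ζ₅ − ζ₅⁴` is generated by the 5th roots of unity). [cite: Washington1997, Ch. 2] -/
theorem zeta5_isCyclotomicExtension [Fact (Irreducible (cmPolyQ R))] : IsCyclotomicExtension {5} ℚ (cmField R) := by
  have hζ := zeta5_isPrimitiveRoot hR
  have ht := cmRoot_quartic R hR
  push_cast at ht
  refine (IsCyclotomicExtension.iff_singleton 5 ℚ (cmField R)).2 ⟨⟨_, hζ⟩, mem_adjoin_of_cmRoot_mem R ?_⟩
  set ζ : cmField R := (cmRoot R - cmRoot R ^ 2 - 3) / 2 with hζdef
  have hmem : ζ ∈ Algebra.adjoin ℚ {b : cmField R | b ^ 5 = 1} := Algebra.subset_adjoin hζ.pow_eq_one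
  have hη : cmRoot R = ζ - ζ ^ 4 := by
    rw [hζdef]
    linear_combination
      (cmRoot R ^ 4 / 16 - cmRoot R ^ 3 / 4 + 13 / 16 * cmRoot R ^ 2 - 5 / 4 * cmRoot R + 21 / 16) * ht
  rw [hη]
  exact Subalgebra.sub_mem _ hmem (Subalgebra.pow_mem _ hmem 4)

end Zeta5

/-! ## §2 `S² + 6S + 1`: `E = ℚ(ζ₈) = ℚ(i, √2)` -/

section Zeta8

variable {R : Polynomial ℤ} (hR : R = X ^ 2 + C 6 * X + C 1)
include hR

/-- **`ζ₈ = (η³ − η² + 7η − 3)/4` is a primitive 8th root of unity in `E = ℚ[T]/(T⁴ + 6T² + 1)`** (`ζ⁴ + 1 = Φ₈(ζ) = 0`;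
`η = i(1+√2)`, `√2 = −(η²+3)/2`, `i = −(η³+5η)/2`, `ζ₈ = (1+i)√2/2`). [cite: Washington1997, Ch. 2] -/
theorem zeta8_isPrimitiveRoot [Fact (Irreducible (cmPolyQ R))] :
    IsPrimitiveRoot ((cmRoot R ^ 3 - cmRoot R ^ 2 + 7 * cmRoot R - 3) / 4 : cmField R) 8 := by
  have ht := cmRoot_quartic R hR
  push_cast at ht
  have h8 : Polynomial.cyclotomic 8 (cmField R) = X ^ 4 + 1 := by
    rw [show (8 : ℕ) = 2 ^ (2 + 1) by norm_num, Polynomial.cyclotomic_prime_pow_eq_geom_sum Nat.prime_two]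
    simp only [Finset.sum_range_succ, Finset.sum_range_zero, zero_add, pow_zero, pow_one]
    ring
  refine Polynomial.isRoot_cyclotomic_iff.1 ?_
  rw [h8, Polynomial.IsRoot.def]
  simp only [eval_add, eval_pow, eval_X, eval_one]
  linear_combination
    (cmRoot R ^ 8 / 256 - cmRoot R ^ 7 / 64 + 7 / 64 * cmRoot R ^ 6 - 19 / 64 * cmRoot R ^ 5
      + 123 / 128 * cmRoot R ^ 4 - 111 / 64 * cmRoot R ^ 3 + 183 / 64 * cmRoot R ^ 2 - 189 / 64 * cmRoot R
      + 337 / 256) * ht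

/-- **`E = ℚ[T]/(T⁴ + 6T² + 1)` is the 8th cyclotomic field: `IsCyclotomicExtension {8} ℚ E`** (`ζ₈ ∈ E` primitive and
`η = ζ₈ + ζ₈² + ζ₈³`). [cite: Washington1997, Ch. 2] -/
theorem zeta8_isCyclotomicExtension [Fact (Irreducible (cmPolyQ R))] : IsCyclotomicExtension {8} ℚ (cmField R) := by
  have hζ := zeta8_isPrimitiveRoot hR
  have ht := cmRoot_quartic R hR
  push_cast at ht
  refine (IsCyclotomicExtension.iff_singleton 8 ℚ (cmField R)).2 ⟨⟨_, hζ⟩, mem_adjoin_of_cmRoot_mem R ?_⟩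
  set ζ : cmField R := (cmRoot R ^ 3 - cmRoot R ^ 2 + 7 * cmRoot R - 3) / 4 with hζdef
  have hmem : ζ ∈ Algebra.adjoin ℚ {b : cmField R | b ^ 8 = 1} := Algebra.subset_adjoin hζ.pow_eq_one
  have hη : cmRoot R = ζ + ζ ^ 2 + ζ ^ 3 := by
    rw [hζdef]
    linear_combination
      (-(cmRoot R ^ 5) / 64 + 3 / 64 * cmRoot R ^ 4 - 9 / 32 * cmRoot R ^ 3 + 15 / 32 * cmRoot R ^ 2
        - 69 / 64 * cmRoot R + 39 / 64) * ht
  rw [hη]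
  exact Subalgebra.add_mem _ (Subalgebra.add_mem _ hmem (Subalgebra.pow_mem _ hmem 2)) (Subalgebra.pow_mem _ hmem 3)

end Zeta8

/-! ## §3 `S² + 8S + 4`: `E = ℚ(ζ₁₂) = ℚ(i, √3)` -/

section Zeta12

variable {R : Polynomial ℤ} (hR : R = X ^ 2 + C 8 * X + C 4)
include hR

/-- `i = −(η³ + 6η)/4` is a primitive 4th root of unity in `E = ℚ[T]/(T⁴ + 8T² + 4)` (`i² + 1 = Φ₄(i) = 0`).
[cite: Washington1997, Ch. 2] -/
theorem zeta12_isPrimitiveRoot_four [Fact (Irreducible (cmPolyQ R))] :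
    IsPrimitiveRoot (-(cmRoot R ^ 3 + 6 * cmRoot R) / 4 : cmField R) 4 := by
  have ht := cmRoot_quartic R hR
  push_cast at ht
  have h4 : Polynomial.cyclotomic 4 (cmField R) = X ^ 2 + 1 := by
    rw [show (4 : ℕ) = 2 ^ (1 + 1) by norm_num, Polynomial.cyclotomic_prime_pow_eq_geom_sum Nat.prime_two]
    simp only [Finset.sum_range_succ, Finset.sum_range_zero, zero_add, pow_zero, pow_one]
    ring
  refine Polynomial.isRoot_cyclotomic_iff.1 ?_
  rw [h4, Polynomial.IsRoot.def]
  simp only [eval_add, eval_pow, eval_X, eval_one]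
  linear_combination (cmRoot R ^ 2 / 16 + 1 / 4) * ht

/-- `ω = (η³ + 10η − 4)/8` is a primitive cube root of unity in `E = ℚ[T]/(T⁴ + 8T² + 4)` (`ω² + ω + 1 = Φ₃(ω) = 0`;
`ω = (−1 + √−3)/2`, `√−3 = η − i`). [cite: Washington1997, Ch. 2] -/
theorem zeta12_isPrimitiveRoot_three [Fact (Irreducible (cmPolyQ R))] :
    IsPrimitiveRoot ((cmRoot R ^ 3 + 10 * cmRoot R - 4) / 8 : cmField R) 3 := by
  have ht := cmRoot_quartic R hR
  push_cast at ht
  haveI : Fact (Nat.Prime 3) := ⟨Nat.prime_three⟩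
  refine Polynomial.isRoot_cyclotomic_iff.1 ?_
  rw [Polynomial.cyclotomic_prime, Polynomial.IsRoot.def]
  simp only [Finset.sum_range_succ, Finset.sum_range_zero, eval_add, eval_pow, eval_X, eval_one, zero_add, pow_zero]
  linear_combination (cmRoot R ^ 2 / 64 + 3 / 16) * ht

/-- **`ζ₁₂ = i·ω` is a primitive 12th root of unity in `E = ℚ[T]/(T⁴ + 8T² + 4)`** (orders `4` and `3` are coprime).
[cite: Washington1997, Ch. 2] -/
theorem zeta12_isPrimitiveRoot [Fact (Irreducible (cmPolyQ R))] :
    IsPrimitiveRoot ((-(cmRoot R ^ 3 + 6 * cmRoot R) / 4) * ((cmRoot R ^ 3 + 10 * cmRoot R - 4) / 8) : cmField R)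
      12 := by
  have hi := zeta12_isPrimitiveRoot_four hR
  have hω := zeta12_isPrimitiveRoot_three hR
  have hord : orderOf ((-(cmRoot R ^ 3 + 6 * cmRoot R) / 4) * ((cmRoot R ^ 3 + 10 * cmRoot R - 4) / 8) : cmField R)
      = 12 := by
    rw [(Commute.all _ _).orderOf_mul_eq_mul_orderOf_of_coprime (by rw [← hi.eq_orderOf, ← hω.eq_orderOf]; decide),
      ← hi.eq_orderOf, ← hω.eq_orderOf]
  rw [← hord]
  exact IsPrimitiveRoot.orderOf _

/-- **`E = ℚ[T]/(T⁴ + 8T² + 4)` is the 12th cyclotomic field: `IsCyclotomicExtension {12} ℚ E`** (`ζ₁₂ = iω ∈ E`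
primitive; `η = 1 + i + 2ω` with `i¹² = ω¹² = 1`). [cite: Washington1997, Ch. 2] -/
theorem zeta12_isCyclotomicExtension [Fact (Irreducible (cmPolyQ R))] : IsCyclotomicExtension {12} ℚ (cmField R) := by
  have hζ := zeta12_isPrimitiveRoot hR
  have hi := zeta12_isPrimitiveRoot_four hR
  have hω := zeta12_isPrimitiveRoot_three hR
  refine (IsCyclotomicExtension.iff_singleton 12 ℚ (cmField R)).2 ⟨⟨_, hζ⟩, mem_adjoin_of_cmRoot_mem R ?_⟩
  set i : cmField R := -(cmRoot R ^ 3 + 6 * cmRoot R) / 4 with hidef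
  set ω : cmField R := (cmRoot R ^ 3 + 10 * cmRoot R - 4) / 8 with hωdef
  have hi12 : i ^ 12 = 1 := by
    rw [show (12 : ℕ) = 4 * 3 by norm_num, pow_mul, hi.pow_eq_one, one_pow]
  have hω12 : ω ^ 12 = 1 := by
    rw [show (12 : ℕ) = 3 * 4 by norm_num, pow_mul, hω.pow_eq_one, one_pow]
  have hmi : i ∈ Algebra.adjoin ℚ {b : cmField R | b ^ 12 = 1} := Algebra.subset_adjoin hi12
  have hmω : ω ∈ Algebra.adjoin ℚ {b : cmField R | b ^ 12 = 1} := Algebra.subset_adjoin hω12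
  have hη : cmRoot R = 1 + i + 2 * ω := by rw [hidef, hωdef]; ring
  rw [hη]
  refine Subalgebra.add_mem _ (Subalgebra.add_mem _ (Subalgebra.one_mem _) hmi) ?_
  exact Subalgebra.mul_mem _ (by exact_mod_cast Subalgebra.natCast_mem _ 2) hmω

end Zeta12

/-! ## §4 `S² + 4S + 2`: `E = ℚ(√-(2+√2)) = ℚ(ζ₁₆ − ζ₁₆⁻¹) ⊂ ℚ(ζ₁₆)` -/

section SqrtNegTwoPlusSqrtTwo

variable {R : Polynomial ℤ} (hR : R = X ^ 2 + C 4 * X + C 2)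
include hR

/-- **The carrier `ℚ[T]/(T⁴ + 4T² + 2)` (`ℚ(√-(2+√2))`, the census's CM subfield of `ℚ(ζ₁₆)`) embeds into every field
with a primitive 16th root of unity `ζ`, by `η ↦ ζ − ζ⁻¹`** (`ζ⁸ = −1` gives `(ζ − ζ⁻¹)² = ζ² − ζ⁶ − 2 = −(2 − √2)` with
`√2 = ζ² + ζ⁻²`, a root of `S² + 4S + 2`). In particular `E ≅ ℚ(ζ₁₆ − ζ₁₆⁻¹) ⊂ ℚ(ζ₁₆)` (take `L = CyclotomicField 16 ℚ`, `ζ = IsCyclotomicExtension.zeta 16 ℚ L`,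
`IsCyclotomicExtension.zeta_spec`). [cite: Washington1997, Ch. 2] -/
theorem sqrtNegTwoPlusSqrtTwo_exists_ringHom_of_isPrimitiveRoot [Fact (Irreducible (cmPolyQ R))]
    {L : Type*} [Field L] [CharZero L] {ζ : L} (hζ : IsPrimitiveRoot ζ 16) :
    ∃ ψ : cmField R →+* L, ψ (cmRoot R) = ζ - ζ⁻¹ := by
  have h8 : ζ ^ 8 = -1 := (hζ.pow (by norm_num) (show 16 = 8 * 2 by norm_num)).eq_neg_one_of_two_right
  have hinv : ζ⁻¹ = -ζ ^ 7 := inv_eq_of_mul_eq_one_right (by linear_combination -h8)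
  have h8' : ζ ^ 8 + 1 = 0 := by rw [h8]; ring
  refine ⟨AdjoinRoot.lift (algebraMap ℚ L) (ζ - ζ⁻¹) ?_, AdjoinRoot.lift_root _⟩
  rw [eval₂_cmPolyQ_of_quadratic R hR, hinv]
  push_cast
  linear_combination (ζ ^ 20 + 4 * ζ ^ 14 - ζ ^ 12 + 6 * ζ ^ 8 + ζ ^ 4 + 4 * ζ ^ 2 + 2) * h8'

end SqrtNegTwoPlusSqrtTwo

end Summit.HodgeConjecture.HodgeConjecture.Ring2.WeilCoverageCM

end
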